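import Literature.NumberTheory.Sieve.DiamondHalberstamPrimeSum
import HarnessLib

/-!
# Two linear forms take `P₅` values: the explicit lower bound for the count (Diamond–Halberstam, Table 1, `g = 2`)

Topic `Literature/NumberTheory/Sieve`. For `H = (a₁X + b₁)(a₂X + b₂)` with `TwoLinear.Admissible`
coefficients (positive, non-proportional, no fixed prime divisor; `DiamondHalberstamTwoLinearSetup.lean`)
this file assembles the weighted sieve of Diamond–Halberstam 1997, Thm 1 (= Halberstam–Richert,
Thm 10.1: Richert's logarithmic weights) from the PROVED ingredients of the tree:

* the combinatorial layer `RichertWeights.card_almostPrimes_ge` (`DiamondHalberstamRichertWeights.lean`),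
  with `r = 5`, `z = N^{73/500}`, `y = N^{270/500}`, `λ = 6173/2700 = 6 − 2/α − 1/100`;
* the lower-bound sieve `PolySieveTwo.card_coprime_ge` at level `D = N^{498/500}`
  (`log D/log z = 498/73`, Iwaniec's `f₂(498/73) ≥ 0.02177 A₂`, `DiamondHalberstamBetaSieveTwo.lean`);
* the weighted prime sum `DH97.weightedPrimeSum_le` (`DiamondHalberstamPrimeSum.lean`);
* the count of values divisible by `p²`, `TwoLinear.card_sq_dvd_val_le`.

Result (`DH97.count_ge`): there are `C₁, C₂ ≥ 0` such that for all `N` with `N^g ≥ 2`,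
`N^g > max(a₁, a₂, |a₁b₂ − a₂b₁|)` and `log((a₁+b₁)(a₂+b₂)) ≤ (α/100) log N`,

  `#{1 ≤ n ≤ N : Ω(H(n)) ≤ 5} ≥ N V(z) (A₂ η₀ − C₁ (θ log N)^{−1/3} − λ⁻¹ (197 A₂ ε_N + C₂ ℓ_N (6 + 197 ε_N)))
     − D e⁸ log² z (1 + λ⁻¹ (6 + ε_N)) − (4N/z + 2(y + 1))`,

with `η₀ = 0.02177 − S_K/λ ≥ 0.0013` (`DH97.eta0_ge`), `ε_N = L₀/(g log N)`,
`ℓ_N = ((θ − α) log N)^{−1/3}`. The passage to the limit (`N V(z) ≫ N/log² N` dominates every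
error term) and the reduction of `DiamondHalberstam1997_twoLinear_P5` to admissible coefficients are
in `DiamondHalberstamLinearAlmostPrimesProofs.lean`.

## References

* H. Diamond, H. Halberstam, LMS LN 237 (1997), 101–107: Thm 1, (2)–(3), special case 1, Table 1.
  [DiamondHalberstam1997]
* H. Halberstam, H.-E. Richert, *Sieve Methods* (1974), Thm 10.1, Thm 10.5. [HalberstamRichert1974]
-/

open Finset Real Polynomial
open scoped ArithmeticFunction.Omega

noncomputable section

namespace Literature.NumberTheory.Sieve

namespace DH97

open RichertWeights TwoLinear

/-! ### The numerical constants -/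

/-- The weight parameter `λ = 6173/2700` (`= 6 − 2/α − 1/100`, `α = 270/500`). [cite: DiamondHalberstam1997, Thm 1 (1)] -/
def lamW : ℝ := 6173 / 2700

/-- `λ > 0`. [folklore] -/
theorem lamW_pos : 0 < lamW := by unfold lamW; norm_num

/-- `λ + 1/100 + 2/α = 6` (`r + 1` with `r = 5`). [folklore] -/
theorem lamW_add : lamW + 1 / 100 + 2 / αExp = 6 := by
  unfold lamW αExp; norm_num

/-- The positive margin `η₀ = 0.02177 − S_K/λ` of the weighted sieve inequality for `r = 5`
(Diamond–Halberstam: "(3) required `r > 4.065…`"; with Iwaniec's `β`-sieve in place of the DHR sieve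
and the present parameters the threshold is `≈ 4.81 < 5`). [cite: DiamondHalberstam1997, Table 1 (g = 2)] -/
def eta0 : ℝ := 2177 / 100000 - pieceSum / lamW

/-- **`η₀ ≥ 0.0013 > 0`** (from the certificate `pieceSum_le`). [cite: DiamondHalberstam1997, Table 1 (g = 2)] -/
theorem eta0_ge : 13 / 10000 ≤ eta0 := by
  unfold eta0 lamW
  have h := pieceSum_le
  have : pieceSum / (6173 / 2700 : ℝ) = pieceSum * (2700 / 6173) := by ring
  rw [this]
  nlinarith

/-- `η₀ > 0`. [folklore] -/
theorem eta0_pos : 0 < eta0 := lt_of_lt_of_le (by norm_num) eta0_ge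

/-- `θ/g = 498/73`: the lower-bound sieve is used at `s₀ = log D/log z = 498/73`. [folklore] -/
theorem θExp_div_gExp : θExp / gExp = 498 / 73 := by unfold θExp gExp; norm_num

/-! ### Identifications between the combinatorial layer and the sieve inputs -/

variable {a₁ b₁ a₂ b₂ : ℕ}

/-- `S_p` of the combinatorial layer is `S_p` of the prime sum: `p ∣ |H(n)| ↔ (p : ℤ) ∣ H(n)`. [folklore] -/
theorem filter_sifted_dvd_eq (N : ℕ) (z : ℝ) (p : ℕ) :
    (sifted (Ioc 0 N) (fun n : ℕ => ((poly a₁ b₁ a₂ b₂).eval (n : ℤ)).natAbs) z).filter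
        (fun n : ℕ => p ∣ ((poly a₁ b₁ a₂ b₂).eval (n : ℤ)).natAbs) =
      (Ioc 0 N).filter fun n : ℕ =>
        ((poly a₁ b₁ a₂ b₂).eval (n : ℤ)).natAbs.Coprime (primesProdBelow z) ∧
          (p : ℤ) ∣ (poly a₁ b₁ a₂ b₂).eval (n : ℤ) := by
  unfold sifted
  rw [Finset.filter_filter]
  refine Finset.filter_congr fun n _ => ?_
  rw [Int.natCast_dvd]

/-! ### The count of values divisible by `p²`, summed over `z ≤ p < y` -/

/-- `#(primesIn z y) ≤ y + 1` (`y ≥ 0`). [folklore] -/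
theorem card_primesIn_le {z y : ℝ} (hy : 0 ≤ y) : (#(primesIn z y) : ℝ) ≤ y + 1 := by
  have h1 : #(primesIn z y) ≤ ⌈y⌉₊ := by
    calc #(primesIn z y) ≤ #(Nat.primesBelow ⌈y⌉₊) := Finset.card_le_card (Finset.filter_subset _ _)
      _ ≤ #(range ⌈y⌉₊) := Finset.card_le_card (Finset.filter_subset _ _)
      _ = ⌈y⌉₊ := Finset.card_range _
  have h2 : (⌈y⌉₊ : ℝ) < y + 1 := Nat.ceil_lt_add_one hy
  have : (#(primesIn z y) : ℝ) ≤ ⌈y⌉₊ := by exact_mod_cast h1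
  linarith

/-- **The non-squarefree contribution**: for admissible coefficients, `z ≥ 2` and
`z > max(a₁, a₂, |a₁b₂ − a₂b₁|)`,
`∑_{z ≤ p < y} #{1 ≤ n ≤ N : p² ∣ H(n)} ≤ 4N/z + 2(y + 1)` (`y ≥ 0`).
[cite: HalberstamRichert1974, Thm 10.1 (condition on `𝒜_{p²}`)] -/
theorem sum_card_sq_dvd_le (h : Admissible a₁ b₁ a₂ b₂) {N : ℕ} {z y : ℝ} (hz : 2 ≤ z) (hy : 0 ≤ y)
    (hbad : (max a₁ (max a₂ (((a₁ : ℤ) * b₂ - a₂ * b₁).natAbs)) : ℝ) < z) :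
    ∑ p ∈ primesIn z y, (#((Ioc 0 N).filter fun n : ℕ => p ^ 2 ∣ val a₁ b₁ a₂ b₂ n) : ℝ) ≤
      4 * N / z + 2 * (y + 1) := by
  have hΔ : ((a₁ : ℤ) * b₂ - a₂ * b₁) ≠ 0 := by
    intro h0
    apply h.hne
    have : ((a₁ * b₂ : ℕ) : ℤ) = ((a₂ * b₁ : ℕ) : ℤ) := by push_cast; linarith
    exact_mod_cast this
  have hterm : ∀ p ∈ primesIn z y,
      (#((Ioc 0 N).filter fun n : ℕ => p ^ 2 ∣ val a₁ b₁ a₂ b₂ n) : ℝ) ≤ 2 * N * (1 / (p : ℝ) ^ 2) + 2 := by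
    intro p hp
    obtain ⟨hpp, hzp, -⟩ := mem_primesIn.mp hp
    have hpgt : (max a₁ (max a₂ (((a₁ : ℤ) * b₂ - a₂ * b₁).natAbs)) : ℝ) < p := lt_of_lt_of_le hbad hzp
    have hpgt' : max a₁ (max a₂ (((a₁ : ℤ) * b₂ - a₂ * b₁).natAbs)) < p := by exact_mod_cast hpgt
    have hpa₁ : ¬ p ∣ a₁ := Nat.not_dvd_of_pos_of_lt h.ha₁ (by omega)
    have hpa₂ : ¬ p ∣ a₂ := Nat.not_dvd_of_pos_of_lt h.ha₂ (by omega)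
    have hpΔ : ¬ (p : ℤ) ∣ (a₁ : ℤ) * b₂ - a₂ * b₁ := by
      intro hd
      have h1 : p ∣ ((a₁ : ℤ) * b₂ - a₂ * b₁).natAbs := Int.natCast_dvd.mp hd
      have h2 : 0 < ((a₁ : ℤ) * b₂ - a₂ * b₁).natAbs := Int.natAbs_pos.mpr hΔ
      have h3 := Nat.le_of_dvd h2 h1
      omega
    have h := card_sq_dvd_val_le (b₁ := b₁) (b₂ := b₂) hpp hpa₁ hpa₂ hpΔ N
    have e : (2 : ℝ) * (N / (p : ℝ) ^ 2 + 1) = 2 * N * (1 / (p : ℝ) ^ 2) + 2 := by ring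
    linarith
  have hsq : ∑ p ∈ primesIn z y, (1 : ℝ) / (p : ℝ) ^ 2 ≤ 2 / z := sum_window_inv_sq_le (z := y) hz
  calc ∑ p ∈ primesIn z y, (#((Ioc 0 N).filter fun n : ℕ => p ^ 2 ∣ val a₁ b₁ a₂ b₂ n) : ℝ)
      ≤ ∑ p ∈ primesIn z y, (2 * N * (1 / (p : ℝ) ^ 2) + 2) := Finset.sum_le_sum hterm
    _ = 2 * N * ∑ p ∈ primesIn z y, 1 / (p : ℝ) ^ 2 + 2 * #(primesIn z y) := by
        rw [Finset.sum_add_distrib, Finset.mul_sum, Finset.sum_const, nsmul_eq_mul, mul_comm (#(primesIn z y) : ℝ)]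
    _ ≤ 2 * N * (2 / z) + 2 * (y + 1) := by
        gcongr
        exact card_primesIn_le hy
    _ = 4 * N / z + 2 * (y + 1) := by ring

/-! ### The explicit lower bound for `#{n ≤ N : Ω(H(n)) ≤ 5}` -/

/-- **The weighted sieve for two linear forms, explicit form** (Diamond–Halberstam Thm 1 with `r = 5`,
`κ = g = 2`, parameters `z = N^{73/500}`, `y = N^{270/500}`, `D = N^{498/500}`, `λ = 6173/2700`,
Iwaniec's `β`-sieve of dimension `2`): there are `C₁, C₂ ≥ 0` such that for every `N` with
`N^g ≥ 2`, `N^g > max(a₁, a₂, |a₁b₂ − a₂b₁|)` and `log((a₁+b₁)(a₂+b₂)) ≤ (α/100) log N`,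
`#{1 ≤ n ≤ N : Ω(H(n)) ≤ 5} ≥ N V(z) (A₂ η₀ − C₁ (θ log N)^{−1/3} − λ⁻¹ (197 A₂ ε_N + C₂ ℓ_N (6 + 197 ε_N)))
− D e⁸ log² z (1 + λ⁻¹ (6 + ε_N)) − (4N/z + 2(y + 1))`.
[cite: DiamondHalberstam1997, Thm 1 with Table 1 (g = 2, r = 5)] -/
theorem count_ge (h : Admissible a₁ b₁ a₂ b₂) :
    ∃ C₁ C₂ : ℝ, 0 ≤ C₁ ∧ 0 ≤ C₂ ∧ ∀ N : ℕ, 2 ≤ (N : ℝ) ^ gExp →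
      (max a₁ (max a₂ (((a₁ : ℤ) * b₂ - a₂ * b₁).natAbs)) : ℝ) < (N : ℝ) ^ gExp →
      Real.log (((a₁ + b₁) * (a₂ + b₂) : ℕ) : ℝ) ≤ αExp / 100 * Real.log N →
        (N : ℝ) * (∏ q ∈ Nat.primesBelow ⌈(N : ℝ) ^ gExp⌉₊,
              (1 - (polyRootCountMod ![poly a₁ b₁ a₂ b₂] q : ℝ) / q)) *
            (iwaniecSieveConst 2 * eta0 - C₁ * (θExp * Real.log N) ^ (-(1 / 3 : ℝ)) -
              lamW⁻¹ * (197 * iwaniecSieveConst 2 * (L₀ / (gExp * Real.log N)) +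
                C₂ * ((θExp - αExp) * Real.log N) ^ (-(1 / 3 : ℝ)) * (6 + 197 * (L₀ / (gExp * Real.log N))))) -
          (N : ℝ) ^ θExp * (Real.exp 8 * Real.log ((N : ℝ) ^ gExp) ^ 2) *
            (1 + lamW⁻¹ * (6 + L₀ / (gExp * Real.log N))) -
          (4 * N / (N : ℝ) ^ gExp + 2 * ((N : ℝ) ^ αExp + 1)) ≤
        #((Ioc 0 N).filter fun n : ℕ => Ω (val a₁ b₁ a₂ b₂ n) ≤ 5) := by
  set H := poly a₁ b₁ a₂ b₂ with hH
  have h2 : polyRootCountMod ![H] 2 ≤ 1 := rootCount_two_le_one h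
  have hle : ∀ p : ℕ, p.Prime → polyRootCountMod ![H] p ≤ 2 := fun p hp => rootCount_le_two h hp
  have hdim : HasIwaniecDimension (rootDensity H) 2 L₀ := hasIwaniecDimension_rootDensity h2 hle
  obtain ⟨C₁', hC₁'⟩ := PolySieveTwo.card_coprime_ge hle hdim
  obtain ⟨C₂, hC₂0, hC₂⟩ := weightedPrimeSum_le h2 hle
  set C₁ := max C₁' 0 with hC₁def
  refine ⟨C₁, C₂, le_max_right _ _, hC₂0, fun N hN hbad hCH => ?_⟩
  -- scales
  set n : ℝ := (N : ℝ) with hndef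
  have hg0 : 0 < gExp := by rw [gExp]; norm_num
  have hα0 : 0 < αExp := by rw [αExp]; norm_num
  have hgα : gExp < αExp := by rw [gExp, αExp]; norm_num
  have hgθ : gExp < θExp := by rw [gExp, θExp]; norm_num
  have hθα : αExp < θExp := by rw [αExp, θExp]; norm_num
  have hn1 : 1 < n := one_lt_of_two_le_rpow (Nat.cast_nonneg N) hg0 hN
  have hn0 : 0 < n := by linarith
  have hN1 : 1 ≤ N := by
    by_contra h0
    push Not at h0
    have : N = 0 := by omega
    rw [hndef, this, Nat.cast_zero] at hn1
    linarith
  have hlogn : 0 < Real.log n := Real.log_pos hn1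
  set z : ℝ := n ^ gExp with hzdef
  set y : ℝ := n ^ αExp with hydef
  set D : ℝ := n ^ θExp with hDdef
  set V : ℝ := ∏ q ∈ Nat.primesBelow ⌈z⌉₊, (1 - (polyRootCountMod ![H] q : ℝ) / q) with hVdef
  set A := iwaniecSieveConst 2 with hAdef
  set ε : ℝ := L₀ / (gExp * Real.log n) with hεdef
  set ℓ : ℝ := ((θExp - αExp) * Real.log n) ^ (-(1 / 3 : ℝ)) with hℓdef
  set e8 : ℝ := Real.exp 8 * Real.log z ^ 2 with he8
  have hz2 : 2 ≤ z := hN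
  have hzy : z ≤ y := Real.rpow_le_rpow_of_exponent_le hn1.le hgα.le
  have hzD : z ≤ D := Real.rpow_le_rpow_of_exponent_le hn1.le hgθ.le
  have hy1 : 1 < y := by linarith
  have hy0 : 0 ≤ y := by linarith
  have hV : 0 < V := prod_one_sub_rootCount_pos h2 hle z
  have hA : 0 < A := BetaSieveTwo.iwaniecSieveConst_two_pos
  -- the value bound `0 < H(n) ≤ X = (a₁+b₁)(a₂+b₂) N²`
  set X : ℝ := (((a₁ + b₁) * (a₂ + b₂) * N ^ 2 : ℕ) : ℝ) with hXdef
  have hx : ∀ m ∈ Ioc 0 N, 0 < H.eval (m : ℤ) ∧ ((H.eval (m : ℤ) : ℤ) : ℝ) ≤ X := by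
    have := eval_pos_le h (N := N) (q := 1) (r := 0) (x := X) le_rfl
    rw [apIndex_one] at this
    exact this
  -- (a) the combinatorial layer
  set v : ℕ → ℕ := fun m => (H.eval (m : ℤ)).natAbs with hvdef
  have hv : ∀ m ∈ Ioc 0 N, v m ≠ 0 ∧ (v m : ℝ) ≤ X := by
    intro m hm
    rw [Finset.mem_Ioc] at hm
    simp only [hvdef, hH, natAbs_eval_poly]
    refine ⟨(val_pos h m).ne', ?_⟩
    rw [hXdef]
    exact_mod_cast val_le hm.1 hm.2
  set CH : ℝ := (((a₁ + b₁) * (a₂ + b₂) : ℕ) : ℝ) with hCHdef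
  have hCHpos : 0 < CH := by
    rw [hCHdef]
    have := h.ha₁; have := h.ha₂
    exact_mod_cast Nat.mul_pos (by omega) (by omega)
  have hXeq : X = CH * n ^ 2 := by rw [hXdef, hCHdef, hndef]; push_cast; ring
  have hr : lamW + Real.log X / Real.log y ≤ (5 : ℕ) + 1 := by
    have hlogy : Real.log y = αExp * Real.log n := by rw [hydef, Real.log_rpow hn0]
    have hlogX : Real.log X = Real.log CH + 2 * Real.log n := by
      rw [hXeq, Real.log_mul hCHpos.ne' (by positivity), Real.log_pow]; push_cast; ring
    rw [hlogy, hlogX]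
    have hαlog : 0 < αExp * Real.log n := mul_pos hα0 hlogn
    have h1 : (Real.log CH + 2 * Real.log n) / (αExp * Real.log n) ≤
        (αExp / 100 * Real.log n + 2 * Real.log n) / (αExp * Real.log n) :=
      div_le_div_of_nonneg_right (by linarith [hCH]) hαlog.le
    have h2 : (αExp / 100 * Real.log n + 2 * Real.log n) / (αExp * Real.log n) = 1 / 100 + 2 / αExp := by
      field_simp
    have h3 := lamW_add
    push_cast
    linarith
  have hW := card_almostPrimes_ge (Ioc 0 N) v z y lamW hy1 lamW_pos hv hr (r := 5)
  -- (b) identify the pieces of the combinatorial inequality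
  have hS_eq : (#(sifted (Ioc 0 N) v z) : ℝ) =
      #((Ioc 0 N).filter fun m : ℕ => (H.eval (m : ℤ)).natAbs.Coprime (primesProdBelow z)) := by
    rfl
  have hT_eq : ∑ p ∈ primesIn z y, logWeight y p * (#((sifted (Ioc 0 N) v z).filter fun m : ℕ => p ∣ v m) : ℝ) =
      Tsum H N := by
    unfold Tsum
    refine Finset.sum_congr rfl fun p _ => ?_
    simp only [hvdef]
    rw [filter_sifted_dvd_eq]
  have hΩ_eq : #((Ioc 0 N).filter fun m : ℕ => Ω (v m) ≤ 5) = #((Ioc 0 N).filter fun m : ℕ => Ω (val a₁ b₁ a₂ b₂ m) ≤ 5) := by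
    simp only [hvdef, hH, natAbs_eval_poly]
  have hE_eq : ∑ p ∈ primesIn z y, (#((Ioc 0 N).filter fun m : ℕ => p ^ 2 ∣ v m) : ℝ) =
      ∑ p ∈ primesIn z y, (#((Ioc 0 N).filter fun m : ℕ => p ^ 2 ∣ val a₁ b₁ a₂ b₂ m) : ℝ) := by
    simp only [hvdef, hH, natAbs_eval_poly]
  rw [hS_eq, hT_eq, hΩ_eq, hE_eq] at hW
  -- (c) the lower-bound sieve at level `D`
  have hS := hC₁' N X z D hz2 hzD hx
  have hs0 : Real.log D / Real.log z = 498 / 73 := by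
    rw [hDdef, hzdef, Real.log_rpow hn0, Real.log_rpow hn0, mul_div_mul_right _ _ hlogn.ne', θExp_div_gExp]
  rw [hs0] at hS
  have hlogD : Real.log D = θExp * Real.log n := by rw [hDdef, Real.log_rpow hn0]
  rw [hlogD] at hS
  have hf0 := BetaSieveTwo.iwaniecLowerSieveFun_two_ge
  -- replace `C₁'` by `C₁ = max C₁' 0`
  have hθ0 : 0 < θExp := by rw [θExp]; norm_num
  have hr1 : 0 ≤ (θExp * Real.log n) ^ (-(1 / 3 : ℝ)) := Real.rpow_nonneg (mul_pos hθ0 hlogn).le _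
  have hS' : n * V * (iwaniecLowerSieveFun 2 (498 / 73) - C₁ * (θExp * Real.log n) ^ (-(1 / 3 : ℝ))) -
      D * e8 ≤ #((Ioc 0 N).filter fun m : ℕ => (H.eval (m : ℤ)).natAbs.Coprime (primesProdBelow z)) := by
    refine le_trans ?_ hS
    have hNV : 0 ≤ n * V := mul_nonneg hn0.le hV.le
    have : C₁' * (θExp * Real.log n) ^ (-(1 / 3 : ℝ)) ≤ C₁ * (θExp * Real.log n) ^ (-(1 / 3 : ℝ)) :=
      mul_le_mul_of_nonneg_right (le_max_left _ _) hr1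
    have := mul_le_mul_of_nonneg_left this hNV
    linarith
  -- (d) the weighted prime sum
  have hT := hC₂ N X hN hx
  -- (e) the non-squarefree contribution
  have hE := sum_card_sq_dvd_le h (N := N) hz2 hy0 hbad
  -- (f) assemble (linear arithmetic)
  have hNV : 0 ≤ n * V := mul_nonneg hn0.le hV.le
  have hlam := lamW_pos
  have hlaminv : 0 < lamW⁻¹ := inv_pos.mpr hlam
  have hmain : n * V * (A * (2177 / 100000)) ≤ n * V * iwaniecLowerSieveFun 2 (498 / 73) :=
    mul_le_mul_of_nonneg_left (by linarith) hNV
  have hTl := mul_le_mul_of_nonneg_left hT hlaminv.le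
  have heta : n * V * (A * eta0) = n * V * (A * (2177 / 100000)) - lamW⁻¹ * (n * V * (A * pieceSum)) := by
    unfold eta0; rw [div_eq_mul_inv]; ring
  -- the inequality `hW`: `S − λ⁻¹ T ≤ #Ω≤5 + E`
  linarith [hW, hS', hTl, hE, hmain, heta]

end DH97

end Literature.NumberTheory.Sieve

end
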